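import Literature.Probability.RandomPlanarGeometry.HexSAWStripSurfaceThresholdClasses
import HarnessLib

/-!
# Left-continuity in the surface fugacity and the critical wall defect of the strip identity (BBdGDCG14 §4.2–4.3 at `y ↑ y*`)

Topic `Literature/Probability/RandomPlanarGeometry` (continues `HexSAWStripSurfaceThresholdClasses.lean` — `HV.bddAbove_stripGFy_of_le`,
`HV.bddAbove_stripGFy_alpha_of_beta` — and, through it, `HexSAWStripSurfaceLimits.lean`: `HV.stripAyLim T y = sup_L A_{T,L}(x_c; y)`,
`HV.stripByLim T y = sup_L B_{T,L}(x_c; y)`, the finite identity (16) `HV.stripIdentityY_holds` and BBdGDCG's Proposition 9 below `y*`,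
`HV.strip_identity_limY_of_lt_yStar`: `cos(3π/8) A_T(x_c;y) + β(y) B_T(x_c;y) = 1` for `0 < y < y* = 1 + √2`).  Source: N. R. Beaton,
M. Bousquet-Mélou, J. de Gier, H. Duminil-Copin, A. J. Guttmann, *The critical fugacity for surface adsorption of self-avoiding walks
on the honeycomb lattice is `1 + √2`*, Comm. Math. Phys. 326 (2014) 727–754, arXiv:1109.0358 (page numbers = arXiv v5): §2 eq. (10)
(p. 6; «the polynomials A_{T,L}, B_{T,L} and E_{T,L}», p. 7), §3.2 and Corollary 8 with its proof (pp. 12–13: the strip series are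
counting series in y — «C_T(x_c; y) is indeed a series in y» — with common radius y_T, and «thus y_T > y_c for all T», proof p. 13),
§4.1 eq. (16) (p. 13), §4.2 (p. 14: bounded monotone limits), §4.3 Proposition 9 eq. (18) (p. 14).  Secondary: N. R. Beaton, A. J. Guttmann,
I. Jensen, *Two-dimensional self-avoiding walks and polymer adsorption: critical fugacity estimates*, J. Phys. A 45 (2012) 055208,
arXiv:1110.6695, §2 eq. (4) (p. 4): «1 = cos(3π/8) A_T(x_c, y_c)» for every width `T` (printed, via `y_c < y_T` and `E_T = 0`).

## What is proved (HOME build of a-idea-1 gen 23, 2026-08-23; door «HEX-YT-RATE» Part V; every `T ≥ 1` is a DCS strip `S_T`)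

In the tree the strip series `y ↦ A_T(x_c; y)`, `y ↦ B_T(x_c; y)` are SUPREMA over `L` of polynomials in `y` with nonnegative
coefficients (not power series with a radius), so the analytic facts print uses silently must be earned:

* `continuous_stripGFy` — each `y ↦ G_{T,L}(x_c; y)` is continuous; `bddAbove_stripBy_of_lt_stripYT` — `B_{T,·}(x_c; y)` is
  bounded in `L` for `0 ≤ y < y_T` (definition of `y_T` as a supremum + monotonicity in `y`);
* `stripByLim_mono_right`, `stripAyLim_mono_right` — `y ≤ y' ⇒ B_T(x_c;y) ≤ B_T(x_c;y')`, `A_T(x_c;y) ≤ A_T(x_c;y')` wherever the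
  larger argument is a bounded one;
* `tendsto_stripByLim_nhdsLT`, `tendsto_stripAyLim_nhdsLT` — **left-continuity**: at every `y₀ > 0` where `L ↦ B_{T,L}(x_c; y₀)`
  (resp. `A_{T,L}`) is bounded, `B_T(x_c; y) → B_T(x_c; y₀)` (resp. `A_T`) as `y ↑ y₀` (a supremum of continuous nondecreasing
  functions is lower semicontinuous and nondecreasing, hence left-continuous);
* `tendsto_stripAyLim_nhdsLT_yStar` — UNCONDITIONALLY `A_T(x_c; y) → A_T(x_c; y*)` as `y ↑ y*` (the arches are bounded AT `y*` by
  (16), since `β(y*) = 0`);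
* ★ `tendsto_betaY_mul_stripByLim_nhdsLT_yStar` — UNCONDITIONALLY, for every `T ≥ 1`, the wall term of Proposition 9 has a limit at
  the critical fugacity: `β(y) B_T(x_c; y) → 1 − cos(3π/8) A_T(x_c; y*)` as `y ↑ y*`; and `tendsto_eps_mul_stripGFy_eps_yStar` — the
  same number is the escape limit `lim_L cos(π/4) E_{T,L}(x_c; y*)`.  So the **critical defect** `δ_T := 1 − cos(3π/8) A_T(x_c; y*) ≥ 0`
  (`one_sub_cos_mul_stripAyLim_yStar_nonneg`) is at once `lim_{y↑y*} β(y) B_T(x_c; y)` and `lim_L cos(π/4) E_{T,L}(x_c; y*)`;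
  in print `δ_T = 0` (BGJ12 eq. (4), through Corollary 8's `y_c < y_T`);
* `cos_mul_stripAyLim_yStar_eq_one_iff_tendsto` — `cos(3π/8) A_T(x_c; y*) = 1 ↔ β(y) B_T(x_c; y) → 0` (`y ↑ y*`);
* ★ `cos_mul_stripAyLim_yStar_eq_one_of_bddAbove` — a second route to the printed critical identity «1 = cos(3π/8) A_T(x_c, y_c)»:
  it holds as soon as `L ↦ B_{T,L}(x_c; y*)` is bounded (then `β(y) B_T(x_c;y) ≤ β(y) B_T(x_c;y*) → 0`), a hypothesis implied by —
  and formally weaker than — the strictness `y* < y_T` of Corollary 8; with `tendsto_stripByLim_nhdsLT_yStar` (`B_T(x_c; ·)` is then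
  left-continuous at `y*` too).

No `sorry`, no new axioms.  Faithfulness: BBdGDCG's `A_T(x_c; y)`, `B_T(x_c; y)` are power series in `y` with radius `y_T > y_c`
(Corollary 8, p. 12; strictness in its proof, p. 13), hence continuous on `[0, y_T)`; the tree's `HV.stripAyLim`/`HV.stripByLim` are the suprema over `L` of the finite-strip
polynomials, equal to those series below `y_T`, and this file proves the one-sided continuity that the limit `y ↑ y*` of (18) needs,
without any radius-of-convergence input.  The defect identity is (16)/(18) in the limit and is not printed as such (print has `δ_T = 0`).
-/

namespace Literature.Probability.RandomPlanarGeometry.SAW.HV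

open Filter Topology Finset

variable {T : ℕ}

/-! ### Continuity and boundedness in `y` -/

/-- Each finite-strip class generating function `y ↦ G_{T,L}(x_c; y) = Σ x_c^{|γ|} y^{c(γ)}` is continuous (a polynomial in `y`).
[cite: BeatonBousquetMelouDeGierDuminilCopinGuttmann2014, §2 eq. (10) (arXiv v5 p. 6; "the polynomials A_{T,L}, B_{T,L} and E_{T,L}", p. 7)] -/
theorem continuous_stripGFy (T L : ℕ) (cls : HV × HV → Prop) [DecidablePred cls] : Continuous fun y : ℝ => stripGFy T L cls y := by
  unfold stripGFy
  exact continuous_finsetSum _ fun P _ => continuous_const.mul (continuous_pow _)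

/-- For `0 ≤ y < y_T` the bridge class `L ↦ B_{T,L}(x_c; y)` is bounded (`T ≥ 1`; `y_T = sup` of the boundedness set, which is an
interval by monotonicity in `y`). [cite: BeatonBousquetMelouDeGierDuminilCopinGuttmann2014, Corollary 8 (arXiv v5 p. 12: y_T is the radius of convergence of B_T(x_c; ·))] -/
theorem bddAbove_stripBy_of_lt_stripYT (hT : 1 ≤ T) {y : ℝ} (hy : 0 ≤ y) (hlt : y < stripYT T) :
    BddAbove (Set.range fun L : ℕ => stripGFy T L (IsBetaDart T) y) := by
  have hne : (stripBddSet T).Nonempty := ⟨yStar / 2, mem_stripBddSet_of_lt hT (half_pos yStar_pos) (half_lt_self yStar_pos)⟩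
  obtain ⟨y', hy'mem, hyy'⟩ := exists_lt_of_lt_csSup hne hlt
  exact bddAbove_stripGFy_of_le T (IsBetaDart T) hy hyy'.le hy'mem.2

/-- At the critical fugacity the arches are bounded by (16) alone: `cos(3π/8) A_{T,L}(x_c; y*) ≤ 1` (`β(y*) = 0`, `E ≥ 0`).
[cite: BeatonBousquetMelouDeGierDuminilCopinGuttmann2014, §4.2 (arXiv v5 p. 14: "Hence the limit lim_{L→∞} A_{T,L}(x_c; y*) exists and is finite")] -/
theorem cos_mul_stripGFy_alpha_yStar_le_one (hT : 1 ≤ T) (L : ℕ) : Real.cos (3 * Real.pi / 8) * stripGFy T L IsAlphaDart yStar ≤ 1 := by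
  have hid := stripIdentityY_holds T L yStar hT yStar_pos
  have hβ : betaY yStar = 0 := by unfold betaY yStar; simp
  have hE : 0 ≤ stripGFy T L (IsEpsDart L) yStar := stripGFy_nonneg' T L _ yStar_pos.le
  rw [hβ, zero_mul, add_zero] at hid
  nlinarith [cos_pi_div_four_pos'.le, mul_nonneg cos_pi_div_four_pos'.le hE]

/-- Hence `L ↦ A_{T,L}(x_c; y*)` is bounded, unconditionally (PRIVATE plumbing: the same statement is the tree's public
`HV.bddAbove_stripGFy_alpha_yStar` in `HexSAWStripSurfaceCriticalArch` (the lane's Part IV, landed p371907), whose olean is not served at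
authoring time — swap this helper for that import at leisure). [cite: BeatonBousquetMelouDeGierDuminilCopinGuttmann2014, §4.2 (arXiv v5 p. 14)] -/
private theorem bddAbove_stripGFy_alpha_yStar_aux (hT : 1 ≤ T) : BddAbove (Set.range fun L : ℕ => stripGFy T L IsAlphaDart yStar) := by
  refine ⟨1 / Real.cos (3 * Real.pi / 8), ?_⟩
  rintro _ ⟨L, rfl⟩
  rw [le_div_iff₀ cos_three_pi_div_eight_pos, mul_comm]
  exact cos_mul_stripGFy_alpha_yStar_le_one hT L

/-! ### Monotonicity in `y` of the strip series -/

/-- `0 ≤ y ≤ y'` and `B_{T,·}(x_c; y')` bounded ⇒ `B_T(x_c; y) ≤ B_T(x_c; y')`.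
[cite: BeatonBousquetMelouDeGierDuminilCopinGuttmann2014, §3.2, Corollary 8 and its proof (arXiv v5 pp. 12–13: counting series in y, "C_T(x_c; y) is indeed a series in y")] -/
theorem stripByLim_mono_right {y y' : ℝ} (hy : 0 ≤ y) (hyy' : y ≤ y')
    (hb : BddAbove (Set.range fun L : ℕ => stripGFy T L (IsBetaDart T) y')) : stripByLim T y ≤ stripByLim T y' :=
  ciSup_mono hb fun L => stripGFy_mono T L _ hy hyy'

/-- `0 ≤ y ≤ y'` and `A_{T,·}(x_c; y')` bounded ⇒ `A_T(x_c; y) ≤ A_T(x_c; y')`.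
[cite: BeatonBousquetMelouDeGierDuminilCopinGuttmann2014, §3.2, Corollary 8 and its proof (arXiv v5 pp. 12–13: counting series in y, "C_T(x_c; y) is indeed a series in y")] -/
theorem stripAyLim_mono_right {y y' : ℝ} (hy : 0 ≤ y) (hyy' : y ≤ y')
    (hb : BddAbove (Set.range fun L : ℕ => stripGFy T L IsAlphaDart y')) : stripAyLim T y ≤ stripAyLim T y' :=
  ciSup_mono hb fun L => stripGFy_mono T L _ hy hyy'

/-! ### Left-continuity: a supremum of continuous nondecreasing functions -/

/-- Generic step: `y ↦ sup_L G_{T,L}(x_c; y)` is left-continuous at every `y₀ > 0` where `L ↦ G_{T,L}(x_c; y₀)` is bounded.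
[cite: BeatonBousquetMelouDeGierDuminilCopinGuttmann2014, §3.2, Corollary 8 and its proof (arXiv v5 pp. 12–13: counting series in y, "C_T(x_c; y) is indeed a series in y"; continuous inside the radius y_T)] -/
theorem tendsto_ciSup_stripGFy_nhdsLT (T : ℕ) (cls : HV × HV → Prop) [DecidablePred cls] {y₀ : ℝ} (hy₀ : 0 < y₀)
    (hb : BddAbove (Set.range fun L : ℕ => stripGFy T L cls y₀)) :
    Tendsto (fun y : ℝ => ⨆ L : ℕ, stripGFy T L cls y) (𝓝[<] y₀) (𝓝 (⨆ L : ℕ, stripGFy T L cls y₀)) := by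
  have hwin : ∀ᶠ y in 𝓝[<] y₀, 0 < y ∧ y < y₀ := by
    filter_upwards [Ioo_mem_nhdsLT hy₀] with y hy using ⟨hy.1, hy.2⟩
  rw [tendsto_order]
  refine ⟨fun a ha => ?_, fun a ha => ?_⟩
  · -- lower semicontinuity: pick `L` with `a < G_{T,L}(y₀)`, then continuity of that one polynomial
    obtain ⟨L, hL⟩ := exists_lt_of_lt_ciSup ha
    have hc : ∀ᶠ y in 𝓝[<] y₀, a < stripGFy T L cls y :=
      eventually_nhdsWithin_of_eventually_nhds (((continuous_stripGFy T L cls).tendsto y₀).eventually_const_lt hL)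
    filter_upwards [hc, hwin] with y hy hw
    exact hy.trans_le (le_ciSup (bddAbove_stripGFy_of_le T cls hw.1.le hw.2.le hb) L)
  · -- monotone: below `y₀` the supremum is at most its value at `y₀ < a`
    filter_upwards [hwin] with y hw
    exact (ciSup_mono hb fun L => stripGFy_mono T L cls hw.1.le hw.2.le).trans_lt ha

/-- **Left-continuity of `B_T(x_c; ·)`** at every `y₀ > 0` where the bridge class is bounded (in particular for `y₀ < y_T`).
[cite: BeatonBousquetMelouDeGierDuminilCopinGuttmann2014, Corollary 8 (arXiv v5 p. 12: B_T(x_c; ·) is a power series with radius y_T)] -/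
theorem tendsto_stripByLim_nhdsLT {y₀ : ℝ} (hy₀ : 0 < y₀) (hb : BddAbove (Set.range fun L : ℕ => stripGFy T L (IsBetaDart T) y₀)) :
    Tendsto (fun y : ℝ => stripByLim T y) (𝓝[<] y₀) (𝓝 (stripByLim T y₀)) :=
  tendsto_ciSup_stripGFy_nhdsLT T (IsBetaDart T) hy₀ hb

/-- **Left-continuity of `A_T(x_c; ·)`** at every `y₀ > 0` where the arch class is bounded (in particular for `y₀ < y_T`, `T ≥ 1`).
[cite: BeatonBousquetMelouDeGierDuminilCopinGuttmann2014, Corollary 8 (arXiv v5 p. 12: A_T(x_c; ·) is a power series with radius y_T)] -/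
theorem tendsto_stripAyLim_nhdsLT {y₀ : ℝ} (hy₀ : 0 < y₀) (hb : BddAbove (Set.range fun L : ℕ => stripGFy T L IsAlphaDart y₀)) :
    Tendsto (fun y : ℝ => stripAyLim T y) (𝓝[<] y₀) (𝓝 (stripAyLim T y₀)) :=
  tendsto_ciSup_stripGFy_nhdsLT T IsAlphaDart hy₀ hb

/-- Below the threshold both series are left-continuous: `0 < y₀ < y_T`, `T ≥ 1`.
[cite: BeatonBousquetMelouDeGierDuminilCopinGuttmann2014, Corollary 8 (arXiv v5 p. 12)] -/
theorem tendsto_stripByLim_nhdsLT_of_lt_stripYT (hT : 1 ≤ T) {y₀ : ℝ} (hy₀ : 0 < y₀) (hlt : y₀ < stripYT T) :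
    Tendsto (fun y : ℝ => stripByLim T y) (𝓝[<] y₀) (𝓝 (stripByLim T y₀)) :=
  tendsto_stripByLim_nhdsLT hy₀ (bddAbove_stripBy_of_lt_stripYT hT hy₀.le hlt)

/-- `A_T(x_c; ·)` is left-continuous at every `0 < y₀ < y_T` (`T ≥ 1`). [cite: BeatonBousquetMelouDeGierDuminilCopinGuttmann2014, Corollary 8 (arXiv v5 p. 12)] -/
theorem tendsto_stripAyLim_nhdsLT_of_lt_stripYT (hT : 1 ≤ T) {y₀ : ℝ} (hy₀ : 0 < y₀) (hlt : y₀ < stripYT T) :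
    Tendsto (fun y : ℝ => stripAyLim T y) (𝓝[<] y₀) (𝓝 (stripAyLim T y₀)) :=
  tendsto_stripAyLim_nhdsLT hy₀ (bddAbove_stripGFy_alpha_of_lt_stripYT hT hy₀.le hlt)

/-! ### At the critical fugacity `y* = 1 + √2` -/

/-- UNCONDITIONALLY `A_T(x_c; y) → A_T(x_c; y*)` as `y ↑ y*` (`T ≥ 1`): the arches are bounded at `y*` by (16).
[cite: BeatonBousquetMelouDeGierDuminilCopinGuttmann2014, §4.2 (arXiv v5 p. 14: lim_L A_{T,L}(x_c; y*) exists and is finite)] -/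
theorem tendsto_stripAyLim_nhdsLT_yStar (hT : 1 ≤ T) :
    Tendsto (fun y : ℝ => stripAyLim T y) (𝓝[<] yStar) (𝓝 (stripAyLim T yStar)) :=
  tendsto_stripAyLim_nhdsLT yStar_pos (bddAbove_stripGFy_alpha_yStar_aux hT)

/-- ★ **The wall term of Proposition 9 has a limit at the critical fugacity, in every strip** (`T ≥ 1`, unconditional):
`β(y) B_T(x_c; y) → 1 − cos(3π/8) A_T(x_c; y*)` as `y ↑ y*` ((18) for `y < y*` and left-continuity of the arches).
[cite: BeatonBousquetMelouDeGierDuminilCopinGuttmann2014, Proposition 9, eq. (18) (arXiv v5 p. 14); lane: the limit y ↑ y* of (18), not printed (print has the limit 0 via Corollary 8)] -/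
theorem tendsto_betaY_mul_stripByLim_nhdsLT_yStar (hT : 1 ≤ T) :
    Tendsto (fun y : ℝ => betaY y * stripByLim T y) (𝓝[<] yStar) (𝓝 (1 - Real.cos (3 * Real.pi / 8) * stripAyLim T yStar)) := by
  have hA := ((tendsto_stripAyLim_nhdsLT_yStar hT).const_mul (Real.cos (3 * Real.pi / 8))).const_sub 1
  refine hA.congr' ?_
  filter_upwards [Ioo_mem_nhdsLT yStar_pos] with y hy
  have hid := strip_identity_limY_of_lt_yStar hT hy.1 (by unfold yStar at hy; exact hy.2)
  linarith

/-- The same number is the escape limit at `y*`: `cos(π/4) E_{T,L}(x_c; y*) → 1 − cos(3π/8) A_T(x_c; y*)` as `L → ∞` ((16) at `y = y*`).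
[cite: BeatonBousquetMelouDeGierDuminilCopinGuttmann2014, §4.1 eq. (16) at y = y* (arXiv v5 p. 13) and §4.2 (p. 14)] -/
theorem tendsto_eps_mul_stripGFy_eps_yStar (hT : 1 ≤ T) :
    Tendsto (fun L : ℕ => Real.cos (Real.pi / 4) * stripGFy T L (IsEpsDart L) yStar) atTop
      (𝓝 (1 - Real.cos (3 * Real.pi / 8) * stripAyLim T yStar)) := by
  have hA : Tendsto (fun L : ℕ => stripGFy T L IsAlphaDart yStar) atTop (𝓝 (stripAyLim T yStar)) :=
    tendsto_atTop_ciSup (fun _ _ h => stripGFy_alpha_mono_L h yStar_pos.le) (bddAbove_stripGFy_alpha_yStar_aux hT)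
  refine ((hA.const_mul (Real.cos (3 * Real.pi / 8))).const_sub 1).congr' (Eventually.of_forall fun L => ?_)
  have hid := stripIdentityY_holds T L yStar hT yStar_pos
  have hβ : betaY yStar = 0 := by unfold betaY yStar; simp
  rw [hβ, zero_mul, add_zero] at hid
  simp only
  linarith

/-- The critical defect is nonnegative: `cos(3π/8) A_T(x_c; y*) ≤ 1` (`T ≥ 1`).
[cite: BeatonBousquetMelouDeGierDuminilCopinGuttmann2014, §4.2 (arXiv v5 p. 14)] -/
theorem one_sub_cos_mul_stripAyLim_yStar_nonneg (hT : 1 ≤ T) : 0 ≤ 1 - Real.cos (3 * Real.pi / 8) * stripAyLim T yStar := by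
  have h : Real.cos (3 * Real.pi / 8) * stripAyLim T yStar ≤ 1 := by
    rw [mul_comm, ← le_div_iff₀ cos_three_pi_div_eight_pos]
    refine ciSup_le fun L => ?_
    rw [le_div_iff₀ cos_three_pi_div_eight_pos, mul_comm]
    exact cos_mul_stripGFy_alpha_yStar_le_one hT L
  linarith

/-- `cos(3π/8) A_T(x_c; y*) = 1` **iff** the wall term vanishes continuously: `β(y) B_T(x_c; y) → 0` as `y ↑ y*` (`T ≥ 1`).
[cite: BeatonBousquetMelouDeGierDuminilCopinGuttmann2014, Proposition 9, eq. (18) (arXiv v5 p. 14); BeatonGuttmannJensen2012Adsorption, §2 eq. (4) (arXiv p. 4: "1 = cos(3π/8) A_T(x_c, y_c)")] -/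
theorem cos_mul_stripAyLim_yStar_eq_one_iff_tendsto (hT : 1 ≤ T) :
    Real.cos (3 * Real.pi / 8) * stripAyLim T yStar = 1 ↔
      Tendsto (fun y : ℝ => betaY y * stripByLim T y) (𝓝[<] yStar) (𝓝 0) := by
  have h := tendsto_betaY_mul_stripByLim_nhdsLT_yStar hT
  constructor
  · intro h1
    rw [h1, sub_self] at h
    exact h
  · intro h0
    have := tendsto_nhds_unique h h0
    linarith

/-- ★ **Second route to the printed critical identity «1 = cos(3π/8) A_T(x_c, y_c)»**: if the bridge class is bounded AT `y*`
(`L ↦ B_{T,L}(x_c; y*)` bounded — implied by Corollary 8's `y_c < y_T`), then `cos(3π/8) A_T(x_c; y*) = 1` (`T ≥ 1`): the wall term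
`β(y) B_T(x_c; y) ≤ β(y) B_T(x_c; y*) → 0`. [cite: BeatonGuttmannJensen2012Adsorption, §2 eq. (4) (arXiv p. 4: "This is a remarkable equation … for any width T"); BeatonBousquetMelouDeGierDuminilCopinGuttmann2014, Proposition 9 (arXiv v5 p. 14) and Corollary 8 (p. 12)] -/
theorem cos_mul_stripAyLim_yStar_eq_one_of_bddAbove (hT : 1 ≤ T)
    (hb : BddAbove (Set.range fun L : ℕ => stripGFy T L (IsBetaDart T) yStar)) :
    Real.cos (3 * Real.pi / 8) * stripAyLim T yStar = 1 := by
  rw [cos_mul_stripAyLim_yStar_eq_one_iff_tendsto hT]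
  have hβc : Tendsto betaY (𝓝[<] yStar) (𝓝 0) := by
    have h0 : betaY yStar = 0 := by unfold betaY yStar; simp
    have hc : ContinuousAt betaY yStar := by
      unfold betaY
      exact ((continuous_const.sub continuous_id).continuousAt).div
        ((continuous_const.mul continuous_id).continuousAt) (by have := yStar_pos; unfold yStar at this ⊢; positivity)
    rw [← h0]
    exact hc.tendsto.mono_left nhdsWithin_le_nhds
  have hup : Tendsto (fun y : ℝ => betaY y * stripByLim T yStar) (𝓝[<] yStar) (𝓝 0) := by
    simpa using hβc.mul_const (stripByLim T yStar)
  refine tendsto_of_tendsto_of_tendsto_of_le_of_le' tendsto_const_nhds hup ?_ ?_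
  · filter_upwards [Ioo_mem_nhdsLT yStar_pos] with y hy
    have hβ : 0 ≤ betaY y := by
      unfold betaY; unfold yStar at hy
      exact div_nonneg (by linarith [hy.2]) (by have := hy.1; positivity)
    have hB : 0 ≤ stripByLim T y := by
      have hs : y < 1 + Real.sqrt 2 := by unfold yStar at hy; exact hy.2
      exact (stripGFy_nonneg' T 0 _ hy.1.le).trans (le_stripByLim hT hy.1 hs 0)
    exact mul_nonneg hβ hB
  · filter_upwards [Ioo_mem_nhdsLT yStar_pos] with y hy
    have hβ : 0 ≤ betaY y := by
      unfold betaY; unfold yStar at hy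
      exact div_nonneg (by linarith [hy.2]) (by have := hy.1; positivity)
    exact mul_le_mul_of_nonneg_left (stripByLim_mono_right hy.1.le hy.2.le hb) hβ

/-- Under the same boundedness `B_T(x_c; ·)` is left-continuous at `y*`: `B_T(x_c; y) → B_T(x_c; y*)` as `y ↑ y*`.
[cite: BeatonBousquetMelouDeGierDuminilCopinGuttmann2014, Corollary 8 (arXiv v5 p. 12: y_T is the radius of B_T(x_c; ·); proof p. 13: "thus y_T > y_c for all T")] -/
theorem tendsto_stripByLim_nhdsLT_yStar (hb : BddAbove (Set.range fun L : ℕ => stripGFy T L (IsBetaDart T) yStar)) :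
    Tendsto (fun y : ℝ => stripByLim T y) (𝓝[<] yStar) (𝓝 (stripByLim T yStar)) :=
  tendsto_stripByLim_nhdsLT yStar_pos hb

/-- Strictness `y* < y_T` supplies that boundedness (so both routes to the critical identity apply below Corollary 8).
[cite: BeatonBousquetMelouDeGierDuminilCopinGuttmann2014, Corollary 8 (arXiv v5 p. 12; proof p. 13: "thus y_T > y_c for all T")] -/
theorem bddAbove_stripBy_yStar_of_lt_stripYT (hT : 1 ≤ T) (h : yStar < stripYT T) :
    BddAbove (Set.range fun L : ℕ => stripGFy T L (IsBetaDart T) yStar) :=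
  bddAbove_stripBy_of_lt_stripYT hT yStar_pos.le h

end Literature.Probability.RandomPlanarGeometry.SAW.HV
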